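import Mathlib
import HarnessLib
import Literature.Analysis.FunctionSpaces.HolderAlgebra
import Literature.Analysis.FluidPDE.VectorCalculus
import Literature.Analysis.FluidPDE.PoincareHomotopyOperatorL2

/-!
# Crux `IsobarTomography.BlobRiccatiClosure` (stmt-NavierStokesRegularity-11740), line
# `type-i-apex-liouville` — Hölder-`½` bookkeeping for the localised vorticity

Helper file (theorems only) `--supports` the item (registered stub `stub_holderHalfTools`). The
div–curl tomography of the velocity gradient behind the apex scale floor feeds the vorticity
`f = curl (χ W) = χ ω + ∇χ × W` of a localised field to the tree's Biot–Savart gradient estimate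
(`exists_norm_fderiv_biotSavart_le`, exponent `γ = ½`), which needs `HolderWith C (1/2) f`; the
constant is assembled from four elementary rules (Majda–Bertozzi, *Vorticity and Incompressible
Flow* (2002), §4.1.1, Lemma 4.1, the "calculus inequalities" (4.16)):

* interpolation — a field bounded by `P` with Lipschitz constant `L` is `½`-Hölder with constant
  `√(2PL)` (`‖f x − f y‖ ≤ min (2P, L d) ≤ √(2P · L d)`), for vector and scalar fields;
* products `χ • g` and `a × b` of bounded `½`-Hölder factors (the tree's bilinear rule
  `FunctionSpaces.holderWith_clm_apply₂` through `ContinuousLinearMap.lsmul` and `crossCLM`,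
  `‖lsmul‖ ≤ 1`, `‖crossCLM‖ ≤ 1` by `norm_cross_le`);
* sums (Mathlib's `HolderWith.add`).
-/

noncomputable section

open scoped NNReal

-- the summit and its single sub-problem share the name (CONVENTIONS §1), as in every Theorems file
set_option linter.dupNamespace false

namespace Summit.NavierStokesRegularity.NavierStokesRegularity.Theorems.BlobRiccatiClosure.TypeIApexLiouville

open Literature.Analysis Literature.Analysis.FluidPDE Literature.Analysis.FunctionSpaces

/-- **Interpolation between a sup bound and a Lipschitz bound**: a map with `‖f‖ ≤ P` and
Lipschitz constant `L` is `½`-Hölder with constant `√(2PL)`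
(`dist (f x) (f y)² ≤ (2P) (L dist x y)`). [folklore] -/
theorem holderWith_half_of_norm_le_of_lipschitzWith {X Y : Type*} [PseudoMetricSpace X]
    [SeminormedAddCommGroup Y] {f : X → Y} {P L : ℝ≥0} (hP : ∀ x, ‖f x‖ ≤ P)
    (hL : LipschitzWith L f) : HolderWith (NNReal.sqrt (2 * P * L)) (1 / 2) f := by
  refine holderWith_of_dist_le fun x y => ?_
  have hexp : ((1 / 2 : ℝ≥0) : ℝ) = 1 / 2 := by norm_num
  have h1 : dist (f x) (f y) ≤ 2 * P := by
    rw [dist_eq_norm, two_mul]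
    exact (norm_sub_le _ _).trans (add_le_add (hP x) (hP y))
  have h2 : dist (f x) (f y) ≤ L * dist x y := hL.dist_le_mul x y
  have h3 : dist (f x) (f y) ^ 2 ≤ 2 * P * L * dist x y := by
    rw [sq, mul_assoc]
    exact mul_le_mul h1 h2 dist_nonneg (by positivity)
  calc dist (f x) (f y) ≤ Real.sqrt (2 * P * L * dist x y) := Real.le_sqrt_of_sq_le h3
    _ = (NNReal.sqrt (2 * P * L) : ℝ) * dist x y ^ ((1 / 2 : ℝ≥0) : ℝ) := by
        rw [Real.sqrt_mul (by positivity), hexp, Real.sqrt_eq_rpow (dist x y)]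
        push_cast
        ring

/-- The scalar-multiplication bilinear map `lsmul ℝ ℝ : ℝ →L E →L E` has operator norm `≤ 1`
(Mathlib's `ContinuousLinearMap.opNNNorm_lsmul_le`, restated in `ℝ≥0`). [folklore] -/
theorem nnnorm_lsmul_real_le_one {F : Type*} [NormedAddCommGroup F] [NormedSpace ℝ F] :
    ‖(ContinuousLinearMap.lsmul ℝ ℝ : ℝ →L[ℝ] F →L[ℝ] F)‖₊ ≤ 1 :=
  ContinuousLinearMap.opNNNorm_lsmul_le

/-- **Product rule `χ • g` for bounded `½`-Hölder factors** (Majda–Bertozzi (4.16) through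
`lsmul`): `|χ| ≤ 1`, `χ` `½`-Hölder with constant `Cχ`, `‖g‖ ≤ P`, `g` `½`-Hölder with
constant `Cg` give `χ • g` `½`-Hölder with constant `Cg + P Cχ`
(`χ x • g x − χ y • g y = χ x • (g x − g y) + (χ x − χ y) • g y`). [folklore] -/
theorem holderWith_half_smul_of_norm_le {X F : Type*} [PseudoMetricSpace X]
    [NormedAddCommGroup F] [NormedSpace ℝ F] {χ : X → ℝ} {g : X → F} {Cχ Cg P : ℝ≥0}
    (hχ1 : ∀ x, ‖χ x‖ ≤ 1) (hχ : HolderWith Cχ (1 / 2) χ) (hgP : ∀ x, ‖g x‖ ≤ P)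
    (hg : HolderWith Cg (1 / 2) g) : HolderWith (Cg + P * Cχ) (1 / 2) (fun y => χ y • g y) := by
  have h := holderWith_clm_apply₂ (ContinuousLinearMap.lsmul ℝ ℝ) hχ hg (Mf := 1)
    (fun x => (hχ1 x).trans_eq NNReal.coe_one.symm) hgP
  simp only [ContinuousLinearMap.lsmul_apply] at h
  refine h.mono ?_
  calc ‖(ContinuousLinearMap.lsmul ℝ ℝ : ℝ →L[ℝ] F →L[ℝ] F)‖₊ * (1 * Cg + Cχ * P)
      ≤ 1 * (1 * Cg + Cχ * P) := mul_le_mul_of_nonneg_right nnnorm_lsmul_real_le_one (by positivity)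
    _ = Cg + P * Cχ := by ring

/-- The cross product `crossCLM : ℝ³ →L ℝ³ →L ℝ³` has operator norm `≤ 1`
(`‖a × b‖ ≤ ‖a‖ ‖b‖`, `norm_cross_le`). [folklore] -/
theorem nnnorm_crossCLM_le_one : ‖crossCLM‖₊ ≤ 1 := by
  rw [← NNReal.coe_le_coe, coe_nnnorm, NNReal.coe_one]
  refine ContinuousLinearMap.opNorm_le_bound₂ crossCLM zero_le_one fun a b => ?_
  rw [one_mul, crossCLM_apply]
  exact norm_cross_le a b

/-- **Product rule `a × b` for bounded `½`-Hölder fields on `ℝ³`** (Majda–Bertozzi (4.16)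
through `crossCLM`): `‖a‖ ≤ Pa`, `a` `½`-Hölder with constant `Ca`, `‖b‖ ≤ Pb`, `b` `½`-Hölder
with constant `Cb` give `a × b` `½`-Hölder with constant `Pa Cb + Pb Ca`
(`a x × b x − a y × b y = a x × (b x − b y) + (a x − a y) × b y`). [folklore] -/
theorem holderWith_half_cross_of_norm_le {X : Type*} [PseudoMetricSpace X]
    {a b : X → EuclideanSpace ℝ (Fin 3)} {Ca Cb Pa Pb : ℝ≥0}
    (haP : ∀ x, ‖a x‖ ≤ Pa) (ha : HolderWith Ca (1 / 2) a) (hbP : ∀ x, ‖b x‖ ≤ Pb)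
    (hb : HolderWith Cb (1 / 2) b) :
    HolderWith (Pa * Cb + Pb * Ca) (1 / 2) (fun y => cross (a y) (b y)) := by
  have h := holderWith_clm_apply₂ crossCLM ha hb haP hbP
  simp only [crossCLM_apply] at h
  refine h.mono ?_
  calc ‖crossCLM‖₊ * (Pa * Cb + Ca * Pb)
      ≤ 1 * (Pa * Cb + Ca * Pb) := mul_le_mul_of_nonneg_right nnnorm_crossCLM_le_one (by positivity)
    _ = Pa * Cb + Pb * Ca := by ring

/-- **Sum rule** for `½`-Hölder fields (Mathlib's `HolderWith.add`, pointwise form). [folklore] -/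
theorem holderWith_half_add {X Y : Type*} [PseudoMetricSpace X] [SeminormedAddCommGroup Y]
    {f g : X → Y} {Cf Cg : ℝ≥0} (hf : HolderWith Cf (1 / 2) f) (hg : HolderWith Cg (1 / 2) g) :
    HolderWith (Cf + Cg) (1 / 2) (fun y => f y + g y) :=
  hf.add hg

/-- **Hölder-`½` toolkit for the localised vorticity** (registered stub `stub_holderHalfTools`):
interpolation `√(2PL)` for bounded Lipschitz vector and scalar fields on `ℝ³`, the product rules
for `χ • g` (constant `Cg + P Cχ`) and `a × b` (constant `Pa Cb + Pb Ca`), and the sum rule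
(constant `Cf + Cg`) (Majda–Bertozzi, *Vorticity and Incompressible Flow* (2002), §4.1.1,
Lemma 4.1 (4.16)). [folklore] -/
theorem stub_holderHalfTools : (∀ (f : EuclideanSpace ℝ (Fin 3) → EuclideanSpace ℝ (Fin 3)) (P L : ℝ≥0), (∀ x, ‖f x‖ ≤ P) → LipschitzWith L f → HolderWith (NNReal.sqrt (2 * P * L)) (1 / 2) f) ∧ (∀ (g : EuclideanSpace ℝ (Fin 3) → ℝ) (P L : ℝ≥0), (∀ x, ‖g x‖ ≤ P) → LipschitzWith L g → HolderWith (NNReal.sqrt (2 * P * L)) (1 / 2) g) ∧ (∀ (χ : EuclideanSpace ℝ (Fin 3) → ℝ) (g : EuclideanSpace ℝ (Fin 3) → EuclideanSpace ℝ (Fin 3)) (Cχ Cg P : ℝ≥0), (∀ x, ‖χ x‖ ≤ 1) → HolderWith Cχ (1 / 2) χ → (∀ x, ‖g x‖ ≤ P) → HolderWith Cg (1 / 2) g → HolderWith (Cg + P * Cχ) (1 / 2) (fun y => χ y • g y)) ∧ (∀ (a b : EuclideanSpace ℝ (Fin 3) → EuclideanSpace ℝ (Fin 3)) (Ca Cb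 Pa Pb : ℝ≥0), (∀ x, ‖a x‖ ≤ Pa) → HolderWith Ca (1 / 2) a → (∀ x, ‖b x‖ ≤ Pb) → HolderWith Cb (1 / 2) b → HolderWith (Pa * Cb + Pb * Ca) (1 / 2) (fun y => cross (a y) (b y))) ∧ (∀ (f g : EuclideanSpace ℝ (Fin 3) → EuclideanSpace ℝ (Fin 3)) (Cf Cg : ℝ≥0), HolderWith Cf (1 / 2) f → HolderWith Cg (1 / 2) g → HolderWith (Cf + Cg) (1 / 2) (fun y => f y + g y)) :=
  ⟨fun _ _ _ hP hL => holderWith_half_of_norm_le_of_lipschitzWith hP hL,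
    fun _ _ _ hP hL => holderWith_half_of_norm_le_of_lipschitzWith hP hL,
    fun _ _ _ _ _ hχ1 hχ hgP hg => holderWith_half_smul_of_norm_le hχ1 hχ hgP hg,
    fun _ _ _ _ _ _ haP ha hbP hb => holderWith_half_cross_of_norm_le haP ha hbP hb,
    fun _ _ _ _ hf hg => holderWith_half_add hf hg⟩

end Summit.NavierStokesRegularity.NavierStokesRegularity.Theorems.BlobRiccatiClosure.TypeIApexLiouville

end
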